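import Mathlib.RingTheory.SimpleModule.Rank
import Mathlib.Topology.Algebra.Group.Matrix
import Literature.NumberTheory.Automorphic.RankinSelbergLocal
import Literature.NumberTheory.Automorphic.RankinSelbergLocalUniqueness
import HarnessLib

/-!
# Local Rankin–Selberg factors for `GL_n × GL_1`: the `GL_1` side (proved)

Companion to `RankinSelbergLocal` (Jacquet–Piatetski-Shapiro–Shalika 1983, §2, Thm. 2.7, and
§3, Thm. 3.1). The named fact `hasRSGamma_tate_compatible` of that file is the case `m = 1` of
the local functional equation: for `π` unramified generic on `GL_n(F)` and `π' = χ ∘ det` on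
`GL_1(F)` (`glOneRep χ`), `γ(s, π × χ, ψ) = ∏ᵢ γ^{Tate}(s, χᵢ χ, ψ)`. Its proof is the theory of
JPSS 1983 (convergence and rationality of the zeta integrals, the functional equation,
multiplicativity of `γ`, and the classification of unramified generic representations), which is
not in the tree. This file proves the purely algebraic `GL_1` side of that statement, so that the
fact reduces to its analytic content:

* `upperUnitriangular_fin_one_eq_bot`: `U_1 = 1`; hence every linear form on a representation of
  `GL_1` is a Whittaker functional (`whittakerFunctionals_eq_top_of_fin_one`) and every non-zero
  representation of `GL_1` is generic (`isGeneric_of_fin_one`).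
* `glOneCentralChar χ = χ ∘ det` is the central character of `glOneRep χ`
  (`glOneRep_hasCentralCharacter`), with `ω(-1) = χ(-1)` (`glOneCentralChar_centerNegOne`), and it
  is the only one (`eq_glOneCentralChar_of_hasCentralCharacter`).
* `glOneRep χ` is irreducible (`isIrreducible_glOneRep`, one-dimensional), smooth and
  admissible as soon as `ker χ` is open (`isSmooth_glOneRep`, `isAdmissible_glOneRep`; every
  quasi-character has open kernel, `isOpen_ker_quasiChar_holds` in `LocalLanglandsGLProofs`), and
  generic (`isGeneric_of_fin_one`) — the hypotheses under which JPSS Thm. 2.7 is stated.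
* The Whittaker functions of `glOneRep χ` and their tildes are explicit:
  `W'(g) = χ(det g) Λ'(v')` (`whittakerModel_glOneRep_apply`),
  `W̃'(g) = χ(det g)⁻¹ Λ'(v')` (`tildeFn_whittakerModel_glOneRep_apply`).
* `rsKernel_mk_of_fin_one`: for `m = 1` the kernel `rsKernel` is the honest JPSS integrand for
  ALL `W`, `W'` (every function on `GL_1` is right-`U_1`-invariant), and
  `rsIntegrand_whittakerModel_glOneRep` makes it explicit against `W' = Λ'(v') χ ∘ det`.
* `hasRSGamma_glOneRep_iff`: for `π' = glOneRep χ` the predicate `HasRSGamma` unfolds to the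
  functional equation `R̃ = χ(-1)^{n-1} γ R` for all Whittaker functions `W_v` of `π` and ALL
  linear forms `Λ'` on `ℂ` (JPSS 1983, Thm. 2.7 (iii) with `ω_{π'}(-1) = χ(-1)`; Cogdell, *Analytic
  theory of L-functions for GL_n*, Thm. 3.2).

No new definitions of notions beyond the explicit central character `glOneCentralChar`, and no
named facts, are introduced (D-0026); everything is proved.

## References

* H. Jacquet, I. I. Piatetski-Shapiro, J. Shalika, *Rankin–Selberg convolutions*, Amer. J. Math.
  105 (1983), 367–464, Thm. 2.7 (iii), Thm. 3.1 [JacquetPiatetskiShapiroShalika1983].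
* J. W. Cogdell, *Analytic theory of `L`-functions for `GL_n`*, in J. Bernstein, S. Gelbart
  (eds.), *An Introduction to the Langlands Program*, Birkhäuser, §3.1, Thm. 3.2 (local functional
  equation with `ω'(-1)^{n-1} γ(s, π × π', ψ)`) and p. 196 (multiplicativity of `γ`) (read).
-/

set_option autoImplicit false

open scoped NNReal
open Matrix MeasureTheory Polynomial
  Literature.NumberTheory.GaloisRepresentations.IsNonarchimedeanLocalField

noncomputable section

namespace Literature.NumberTheory.Automorphic

/-! ### `U_1` is trivial: Whittaker functionals and genericity for `GL_1` -/

section UOne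

variable {R : Type*} [CommRing R]

/-- The upper unitriangular subgroup of `GL_1` is trivial: a `1 × 1` matrix with diagonal `1` is
the identity. [folklore] -/
theorem upperUnitriangular_fin_one_eq_bot : upperUnitriangular (Fin 1) R = ⊥ := by
  refine (Subgroup.eq_bot_iff_forall _).2 fun u hu => ?_
  rw [mem_upperUnitriangular_iff] at hu
  ext i j
  obtain rfl : i = 0 := Subsingleton.elim _ _
  obtain rfl : j = 0 := Subsingleton.elim _ _
  rw [hu.2 0, Units.val_one, Matrix.one_apply_eq]

/-- Every element of `U_1` is `1`. [folklore] -/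
theorem upperUnitriangular_fin_one_coe_eq_one (u : ↥(upperUnitriangular (Fin 1) R)) :
    (u : GL (Fin 1) R) = 1 :=
  (Subgroup.eq_bot_iff_forall _).1 upperUnitriangular_fin_one_eq_bot _ u.2

/-- The generic character of `U_1` is trivial. [folklore] -/
theorem whittakerCharFun_fin_one (ψ : AddChar R Circle) (u : ↥(upperUnitriangular (Fin 1) R)) :
    whittakerCharFun ψ u = 1 := by
  have h1 : u = 1 := Subtype.ext (upperUnitriangular_fin_one_coe_eq_one u)
  rw [h1, whittakerCharFun_apply, superdiagSum_one, AddChar.map_zero_eq_one, Circle.coe_one]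

variable {V' : Type*} [AddCommGroup V'] [Module ℂ V']

/-- **Every linear form on a representation of `GL_1` is a Whittaker functional**: the defining
condition `Λ(π(u) v) = ψ_U(u) Λ(v)` is empty since `U_1 = 1`. (Jacquet–Piatetski-Shapiro–Shalika
1983, §2: for `m = 1` the Whittaker model of `π' = χ` is `ℂ χ`.) [folklore] -/
theorem whittakerFunctionals_eq_top_of_fin_one (π' : Representation ℂ (GL (Fin 1) R) V')
    (ψ : AddChar R Circle) : whittakerFunctionals π' ψ = ⊤ := by
  refine eq_top_iff.2 fun Λ _ => (mem_whittakerFunctionals_iff Λ).2 fun u v => ?_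
  rw [upperUnitriangular_fin_one_coe_eq_one u, map_one, whittakerCharFun_fin_one, one_mul]
  rfl

/-- Every non-zero representation of `GL_1` is generic (for every `ψ`): any non-zero linear
form is a non-zero Whittaker functional. [folklore] -/
theorem isGeneric_of_fin_one [Nontrivial V'] (π' : Representation ℂ (GL (Fin 1) R) V')
    (ψ : AddChar R Circle) : IsGeneric π' ψ := by
  rw [IsGeneric, whittakerFunctionals_eq_top_of_fin_one]
  exact top_ne_bot

end UOne

/-! ### The representation `χ ∘ det` of `GL_1`: central character, Whittaker functions -/

section GLOneRep

variable {F : Type*} [Field F]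

/-- `det(-1) = -1` in `GL_1`. [folklore] -/
theorem det_neg_one_fin_one :
    Matrix.GeneralLinearGroup.det (-1 : GL (Fin 1) F) = -1 := by
  ext
  rw [Matrix.GeneralLinearGroup.val_det_apply, Units.val_neg, Units.val_one, Matrix.det_neg,
    Matrix.det_one, Fintype.card_fin, Units.val_neg, Units.val_one]
  ring

/-- The character `χ ∘ det` of the centre `Z(GL_1) = GL_1` — the central character of
`glOneRep χ`. [folklore] -/
def glOneCentralChar (χ : Fˣ →* ℂˣ) : Subgroup.center (GL (Fin 1) F) →* ℂˣ :=
  (χ.comp Matrix.GeneralLinearGroup.det).comp (Subgroup.center (GL (Fin 1) F)).subtype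

/-- Unfolding lemma for `glOneCentralChar`. [folklore] -/
@[simp] lemma glOneCentralChar_apply (χ : Fˣ →* ℂˣ) (z : Subgroup.center (GL (Fin 1) F)) :
    glOneCentralChar χ z = χ (Matrix.GeneralLinearGroup.det (z : GL (Fin 1) F)) :=
  rfl

/-- `ω(-1) = χ(-1)` for the central character `ω = χ ∘ det` of `glOneRep χ`: the sign
`ω_{π'}(-1)^{n-1}` of the functional equation of `GL_n × GL_1` is `χ(-1)^{n-1}`
(Jacquet–Piatetski-Shapiro–Shalika 1983, Thm. 2.7 (iii)). [folklore] -/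
theorem glOneCentralChar_centerNegOne (χ : Fˣ →* ℂˣ) :
    glOneCentralChar χ (centerNegOne 1 F) = χ (-1) := by
  rw [glOneCentralChar_apply, coe_centerNegOne, det_neg_one_fin_one]

/-- **`glOneRep χ` has central character `χ ∘ det`** (every element of `GL_1` is central and
acts by `χ(det g)`). [folklore] -/
theorem glOneRep_hasCentralCharacter (χ : Fˣ →* ℂˣ) :
    (glOneRep χ).HasCentralCharacter (glOneCentralChar χ) :=
  fun _ => rfl

/-- The central character of `glOneRep χ` is unique: any `ω` with
`(glOneRep χ).HasCentralCharacter ω` equals `χ ∘ det` (the space `ℂ` is non-zero). [folklore] -/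
theorem eq_glOneCentralChar_of_hasCentralCharacter {χ : Fˣ →* ℂˣ}
    {ω : Subgroup.center (GL (Fin 1) F) →* ℂˣ} (hω : (glOneRep χ).HasCentralCharacter ω) :
    ω = glOneCentralChar χ :=
  MonoidHom.ext fun z => hasCentralCharacter_apply_eq hω (glOneRep_hasCentralCharacter χ) z

/-- The Whittaker functions of `glOneRep χ` are the multiples of `χ ∘ det`:
`W'_{v'}(g) = Λ'(χ(det g) v') = χ(det g) Λ'(v')`. [folklore] -/
theorem whittakerModel_glOneRep_apply (χ : Fˣ →* ℂˣ) (Λ' : Module.Dual ℂ ℂ) (v' : ℂ)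
    (g : GL (Fin 1) F) :
    whittakerModel (glOneRep χ) Λ' v' g =
      ((χ (Matrix.GeneralLinearGroup.det g) : ℂˣ) : ℂ) * Λ' v' := by
  rw [whittakerModel_apply, glOneRep_apply, ← smul_eq_mul, map_smul, smul_eq_mul]

/-- `det(w_1 ᵗg⁻¹) = (det g)⁻¹` in `GL_1` (indeed `w_1 = 1`). [folklore] -/
theorem det_weylLong_mul_glTransposeInv [TopologicalSpace F] (g : GL (Fin 1) F) :
    Matrix.GeneralLinearGroup.det
        (weylLong 1 F * GaloisRepresentations.glTransposeInv (Fin 1) F g) =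
      (Matrix.GeneralLinearGroup.det g)⁻¹ := by
  rw [map_mul]
  have h1 : Matrix.GeneralLinearGroup.det (weylLong 1 F) = 1 := by
    ext
    rw [Matrix.GeneralLinearGroup.val_det_apply, coe_weylLong, Matrix.det_permutation,
      Units.val_one]
    have : (Fin.revPerm : Equiv.Perm (Fin 1)) = 1 := Subsingleton.elim _ _
    rw [this, Equiv.Perm.sign_one, Units.val_one, Int.cast_one]
  have h2 : Matrix.GeneralLinearGroup.det (GaloisRepresentations.glTransposeInv (Fin 1) F g) =
      (Matrix.GeneralLinearGroup.det g)⁻¹ := by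
    rw [← map_inv]
    ext
    rw [Matrix.GeneralLinearGroup.val_det_apply, Matrix.GeneralLinearGroup.val_det_apply,
      GaloisRepresentations.coe_glTransposeInv_apply, Matrix.det_transpose]
  rw [h1, h2, one_mul]

/-- The tilde of a Whittaker function of `glOneRep χ`:
`W̃'(g) = W'(w_1 ᵗg⁻¹) = χ(det g)⁻¹ Λ'(v')` — a Whittaker function of `glOneRep χ⁻¹`, the
contragredient character (Jacquet–Piatetski-Shapiro–Shalika 1983, §2 (2.1)). [folklore] -/
theorem tildeFn_whittakerModel_glOneRep_apply [TopologicalSpace F] (χ : Fˣ →* ℂˣ)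
    (Λ' : Module.Dual ℂ ℂ) (v' : ℂ) (g : GL (Fin 1) F) :
    tildeFn (whittakerModel (glOneRep χ) Λ' v') g =
      ((χ (Matrix.GeneralLinearGroup.det g) : ℂˣ) : ℂ)⁻¹ * Λ' v' := by
  rw [tildeFn_apply, whittakerModel_glOneRep_apply, det_weylLong_mul_glTransposeInv, map_inv,
    Units.val_inv_eq_inv_val]

/-- **`glOneRep χ` is irreducible**: it is one-dimensional, so its only subrepresentations are
`⊥` and `⊤` (the only subspaces of `ℂ` are). [folklore] -/
theorem isIrreducible_glOneRep (χ : Fˣ →* ℂˣ) : (glOneRep χ).IsIrreducible := by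
  have hs : IsSimpleModule ℂ ℂ := isSimpleModule_iff_finrank_eq_one.2 (Module.finrank_self ℂ)
  have hinj := Subrepresentation.toSubmodule_injective (ρ := glOneRep χ)
  have hbot : (⊥ : Subrepresentation (glOneRep χ)).toSubmodule = ⊥ := rfl
  have htop : (⊤ : Subrepresentation (glOneRep χ)).toSubmodule = ⊤ := rfl
  haveI : Nontrivial (Subrepresentation (glOneRep χ)) := ⟨⟨⊥, ⊤, fun e => by
    have := congrArg Subrepresentation.toSubmodule e
    rw [hbot, htop] at this
    exact bot_ne_top this⟩⟩
  refine ⟨fun W => ?_⟩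
  rcases eq_bot_or_eq_top W.toSubmodule with hW | hW
  · exact Or.inl (hinj (hW.trans hbot.symm))
  · exact Or.inr (hinj (hW.trans htop.symm))

variable [TopologicalSpace F] [IsTopologicalRing F]

/-- The kernel of `χ ∘ det` on `GL_1(F)` is open when `ker χ` is open. [folklore] -/
theorem isOpen_ker_comp_det {χ : Fˣ →* ℂˣ} (hχ : IsOpen ((χ.ker : Subgroup Fˣ) : Set Fˣ)) :
    IsOpen (((χ.comp (Matrix.GeneralLinearGroup.det (n := Fin 1) (R := F))).ker :
      Subgroup (GL (Fin 1) F)) : Set (GL (Fin 1) F)) := by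
  have h : (((χ.comp (Matrix.GeneralLinearGroup.det (n := Fin 1) (R := F))).ker :
      Subgroup (GL (Fin 1) F)) : Set (GL (Fin 1) F)) =
      Matrix.GeneralLinearGroup.det ⁻¹' ((χ.ker : Subgroup Fˣ) : Set Fˣ) := by
    ext g
    simp [MonoidHom.mem_ker]
  rw [h]
  exact hχ.preimage Matrix.GeneralLinearGroup.continuous_det

/-- **`glOneRep χ` is smooth** as soon as `ker χ` is open — which every quasi-character of a
non-archimedean local field satisfies (`isOpen_ker_quasiChar_holds` of `LocalLanglandsGLProofs`:
`ℂˣ` has no small subgroups): the stabiliser of every vector contains the open subgroup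
`ker (χ ∘ det)`. (Bushnell–Henniart 2006, §1.5: characters of `Fˣ` are smooth.) [folklore] -/
theorem isSmooth_glOneRep {χ : Fˣ →* ℂˣ} (hχ : IsOpen ((χ.ker : Subgroup Fˣ) : Set Fˣ)) :
    (glOneRep χ).IsSmooth := by
  intro v
  refine Subgroup.isOpen_mono ?_ (isOpen_ker_comp_det hχ)
  intro g hg
  rw [MonoidHom.mem_ker, MonoidHom.comp_apply] at hg
  rw [Representation.mem_stabilizerSubgroup, glOneRep_apply, hg, Units.val_one, one_mul]

/-- **`glOneRep χ` is admissible** (for `ker χ` open): smooth, and every space of fixed vectors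
is a subspace of `ℂ`, hence finite-dimensional. [folklore] -/
theorem isAdmissible_glOneRep {χ : Fˣ →* ℂˣ} (hχ : IsOpen ((χ.ker : Subgroup Fˣ) : Set Fˣ)) :
    (glOneRep χ).IsAdmissible :=
  ⟨isSmooth_glOneRep hχ, fun _ _ => inferInstance⟩

end GLOneRep

/-! ### `HasRSGamma` for `GL_n × GL_1` -/

section HasRSGammaGLOne

variable {F : Type*} [Field F] [ValuativeRel F] [TopologicalSpace F] [IsNonarchimedeanLocalField F]
  {n : ℕ} {V : Type*} [AddCommGroup V] [Module ℂ V]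
  [MeasurableSpace (GL (Fin 1) F ⧸ upperUnitriangular (Fin 1) F)] [MeasurableSpace F]

/-- **The functional equation of `GL_n × GL_1` unfolded.** For `π' = glOneRep χ` (`χ ∘ det` on
`GL_1(F)`), `HasRSGamma hn π (glOneRep χ) ψ μ ν₁ γ` says exactly: for every Whittaker functional
`Λ` of `π`, every `v`, and every linear form `Λ'` on `ℂ` and `v' ∈ ℂ` (all of which are Whittaker
data for `GL_1`, `whittakerFunctionals_eq_top_of_fin_one`), there are `R, R̃ ∈ ℂ(T)` interpolating
`Ψ(s; W_v, W'_{v'})` on a right half-plane and `Ψ̃(1 - s; ρ(w_{n,1}) W̃_v, W̃'_{v'})` on a left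
half-plane with `R̃ = χ(-1)^{n-1} γ R` — the central character of `π'` being `χ ∘ det`
(`glOneRep_hasCentralCharacter`, unique by `eq_glOneCentralChar_of_hasCentralCharacter`).
(Jacquet–Piatetski-Shapiro–Shalika 1983, Thm. 2.7 (iii) for `m = 1`; Cogdell, Thm. 3.2.)
[cite: JacquetPiatetskiShapiroShalika1983, Thm. 2.7 (iii)] -/
theorem hasRSGamma_glOneRep_iff (hn : 1 < n) (π : Representation ℂ (GL (Fin n) F) V)
    (χ : Fˣ →* ℂˣ) (ψ : AddChar F Circle) (μ : Measure F)
    (ν₁ : Measure (GL (Fin 1) F ⧸ upperUnitriangular (Fin 1) F)) (γ : RatFunc ℂ) :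
    HasRSGamma hn π (glOneRep χ) ψ μ ν₁ γ ↔
      ∀ Λ ∈ whittakerFunctionals π ψ, ∀ (Λ' : Module.Dual ℂ ℂ) (v : V) (v' : ℂ),
        ∃ R Rt : RatFunc ℂ,
          EqOnRightHalfPlane (residueFieldCard F)
            (rsZeta hn ν₁ (whittakerModel π Λ v) (whittakerModel (glOneRep χ) Λ' v')) R ∧
          EqOnLeftHalfPlane (residueFieldCard F)
            (fun s => rsZetaTilde hn μ ν₁
              (fun g => tildeFn (whittakerModel π Λ v) (g * weylNM F hn.le))
              (tildeFn (whittakerModel (glOneRep χ) Λ' v')) (1 - s)) Rt ∧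
          Rt = RatFunc.C (((χ (-1) : ℂˣ) : ℂ) ^ (n - 1)) * γ * R := by
  constructor
  · rintro ⟨ω, hω, h⟩ Λ hΛ Λ' v v'
    have hΛ' : Λ' ∈ whittakerFunctionals (glOneRep χ) ψ⁻¹ := by
      rw [whittakerFunctionals_eq_top_of_fin_one]; trivial
    obtain ⟨R, Rt, hR, hRt, hE⟩ := h Λ hΛ Λ' hΛ' v v'
    refine ⟨R, Rt, hR, hRt, ?_⟩
    rwa [eq_glOneCentralChar_of_hasCentralCharacter hω, glOneCentralChar_centerNegOne] at hE
  · intro h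
    refine ⟨glOneCentralChar χ, glOneRep_hasCentralCharacter χ, fun Λ hΛ Λ' _ v v' => ?_⟩
    obtain ⟨R, Rt, hR, hRt, hE⟩ := h Λ hΛ Λ' v v'
    refine ⟨R, Rt, hR, hRt, ?_⟩
    rwa [glOneCentralChar_centerNegOne]

/-- In particular the sign of the `GL_n × GL_1` functional equation is `χ(-1)^{n-1}`: if
`HasRSGamma hn π (glOneRep χ) ψ μ ν₁ γ` then for all Whittaker data the interpolating rational
functions satisfy `R̃ = χ(-1)^{n-1} γ R`. [folklore] -/
theorem HasRSGamma.glOneRep_exists_ratFunc {hn : 1 < n} {π : Representation ℂ (GL (Fin n) F) V}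
    {χ : Fˣ →* ℂˣ} {ψ : AddChar F Circle} {μ : Measure F}
    {ν₁ : Measure (GL (Fin 1) F ⧸ upperUnitriangular (Fin 1) F)} {γ : RatFunc ℂ}
    (h : HasRSGamma hn π (glOneRep χ) ψ μ ν₁ γ) {Λ : Module.Dual ℂ V}
    (hΛ : Λ ∈ whittakerFunctionals π ψ) (Λ' : Module.Dual ℂ ℂ) (v : V) (v' : ℂ) :
    ∃ R Rt : RatFunc ℂ,
      EqOnRightHalfPlane (residueFieldCard F)
        (rsZeta hn ν₁ (whittakerModel π Λ v) (whittakerModel (glOneRep χ) Λ' v')) R ∧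
      EqOnLeftHalfPlane (residueFieldCard F)
        (fun s => rsZetaTilde hn μ ν₁
          (fun g => tildeFn (whittakerModel π Λ v) (g * weylNM F hn.le))
          (tildeFn (whittakerModel (glOneRep χ) Λ' v')) (1 - s)) Rt ∧
      Rt = RatFunc.C (((χ (-1) : ℂˣ) : ℂ) ^ (n - 1)) * γ * R :=
  (hasRSGamma_glOneRep_iff hn π χ ψ μ ν₁ γ).1 h Λ hΛ Λ' v v'

omit [ValuativeRel F] [TopologicalSpace F] [IsNonarchimedeanLocalField F]
  [MeasurableSpace (GL (Fin 1) F ⧸ upperUnitriangular (Fin 1) F)] [MeasurableSpace F] in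
/-- For `m = 1` every function on `GL_1` is right-`U_1`-invariant (`U_1 = 1`). [folklore] -/
theorem isRightUInvariant_of_fin_one (f : GL (Fin 1) F → ℂ) : IsRightUInvariant f :=
  fun g u => by rw [upperUnitriangular_fin_one_coe_eq_one u, mul_one]

omit [MeasurableSpace (GL (Fin 1) F ⧸ upperUnitriangular (Fin 1) F)] [MeasurableSpace F] in
/-- **For `GL_n × GL_1` the Rankin–Selberg kernel is always the honest integrand**: since
`U_1 = 1`, `rsKernel hn W W' s (g U_1) = rsIntegrand hn W W' s g = W(diag(g⁻¹, 1)) W'(g⁻¹)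
|det g⁻¹|^{s - (n-1)/2}` for ALL `W`, `W'` (no Whittaker hypothesis is needed for the descent,
and the junk branch of `rsKernel` is never taken). (Jacquet–Piatetski-Shapiro–Shalika 1983, §2.4
with `m = 1`: `Ψ(s; W, χ) = ∫_{Fˣ} W(diag(a, 1)) χ(a) |a|^{s-(n-1)/2} d×a`.) [folklore] -/
theorem rsKernel_mk_of_fin_one (hn : 1 < n) (W : GL (Fin n) F → ℂ) (W' : GL (Fin 1) F → ℂ)
    (s : ℂ) (g : GL (Fin 1) F) :
    rsKernel hn W W' s (g : GL (Fin 1) F ⧸ upperUnitriangular (Fin 1) F) =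
      rsIntegrand hn W W' s g :=
  rsKernel_mk hn (isRightUInvariant_of_fin_one _) g

omit [MeasurableSpace (GL (Fin 1) F ⧸ upperUnitriangular (Fin 1) F)] [MeasurableSpace F] in
/-- The `GL_n × GL_1` integrand against a Whittaker function `W'_{v'} = Λ'(v') · χ ∘ det` of
`glOneRep χ`: `W(diag(g⁻¹, 1)) · χ(det g)⁻¹ Λ'(v') · |det g⁻¹|^{s - (n-1)/2}`. [folklore] -/
theorem rsIntegrand_whittakerModel_glOneRep (hn : 1 < n) (W : GL (Fin n) F → ℂ) (χ : Fˣ →* ℂˣ)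
    (Λ' : Module.Dual ℂ ℂ) (v' : ℂ) (s : ℂ) (g : GL (Fin 1) F) :
    rsIntegrand hn W (whittakerModel (glOneRep χ) Λ' v') s g =
      W (glCorner F hn.le g⁻¹) *
        (((χ (Matrix.GeneralLinearGroup.det g) : ℂˣ) : ℂ)⁻¹ * Λ' v') *
        (((normAbs F ((Matrix.GeneralLinearGroup.det g⁻¹ : Fˣ) : F) : ℝ≥0) : ℝ) : ℂ) ^
          (s - ((n : ℂ) - 1) / 2) := by
  rw [rsIntegrand, whittakerModel_glOneRep_apply, map_inv Matrix.GeneralLinearGroup.det g, map_inv χ,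
    Units.val_inv_eq_inv_val, Nat.cast_one]

end HasRSGammaGLOne

end Literature.NumberTheory.Automorphic
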